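import Summits.BirchSwinnertonDyer.BirchSwinnertonDyer.Theorems.KatoDescentTamePotSupersingularJetchevIrreducibleCebotarevPrimes
import Literature.NumberTheory.EllipticCurves.ModPImageScalarThreeProofs
import Literature.NumberTheory.EllipticCurves.SemistableModPImageIrreducibleProofs
import Summits.BirchSwinnertonDyer.Rank1Residual.X11b.SplitPrimeUnramified
import HarnessLib

/-!
# Crux `JetchevIrreducibleReadingByName` (item 20165): the image hypotheses (Z), (S), (C) of
# McCallum's Cor. 3.2 over the Heegner field `K`, DISCHARGED from `E[p]` irreducible + `K ∩ ℚ(E[p]) = ℚ`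
# (the latter from: `K` unramified at `p` and at the bad primes — e.g. the Heegner hypothesis with
# `p ∣ N_E`) — the inputs that make the irreducible reading of [McC] Cor. 3.2 a theorem (sequel);
# seat `bsd-potss-k8t-c4` g9; route-free; `--supports 20165`, helper; nothing booked, no item closed,
# BSD is not proved by this

WHY. `…JetchevIrreducibleCebotarevPrimes.cor32_localOrder_of_image` is McCallum 1991 Cor. 3.2 at
level `p^M` for any `(E, K, p)` whose `Γ_K`-module `E(K̄)[p]` has (S) simplicity, (C) scalar
commutant, (Z) a scalar `a ≢ 1 (mod p)` realised by `Γ_K`. This file supplies (S), (C), (Z):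

* §1 `forall_exists_absGaloisRestrict_smul_eq_of_unramified` — **`ρ̄_{E,p}(Γ_K) = ρ̄_{E,p}(Γ_ℚ)`**
  for a quadratic field `K` unramified at `p` and at every prime of bad reduction: otherwise
  `Γ_{ℚ(E[p])} ≤ Γ_K` (index `2`), every inertia group of `Γ_ℚ` lies in `Γ_K` (`E[p]` is unramified
  at good `q ≠ p`, Silverman VII.4.1 = the tree's `galoisRepTorsion_eq_one_of_mem_inertia`; `K` is
  unramified at the others), and `ℚ` has no everywhere-unramified quadratic extension (Minkowski,
  the tree's `WeierstrassCurve.false_of_index_two_of_forall_inertia_le`). Heegner corollary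
  `…_of_satisfiesHeegnerHypothesis` (all `q ∣ N_E` split in `K`, `p ∣ N_E`; x11b's
  `isUnramifiedIn_of_satisfiesHeegnerHypothesis_of_dvd`).
* §2 `simple_baseChange_of_irreducible`, `exists_eq_zsmul_baseChange_of_irreducible` — (S) and (C)
  for `Γ_K` on `E(K̄)[p]` from `W.HasIrreducibleModPGaloisRep p` and §1's conclusion (absolute
  irreducibility through complex conjugation: an equivariant endomorphism preserves the
  `c₀`-eigenline `E[p]⁺ = 𝔽_p e₊`, so has an eigenvalue, whose eigenspace is stable, hence everything).
* §3 `exists_smul_eq_smul_baseChange_of_irreducible` — (Z): a scalar `a ≢ 1` in `ρ̄_{E,p}(Γ_K)`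
  for EVERY odd `p` with `E[p]` irreducible: `-1` if `ρ̄` is onto; else the tree's Serre §2.6 theorems
  `WeierstrassCurve.exists_galoisRepTorsion_eq_smul_of_not_surjective` (`p ≥ 5`, cell bsd-smallim) /
  `…_three` (`p = 3`); transported to `Γ_K` by §1.
* (sequel `…JetchevIrreducibleCebotarevIrreducible`) the corrected reading h32I′ = `h32I` of
  p507696/p508713 WITH the binders `SatisfiesHeegnerHypothesis (W.conductorNorm ℤ) K`,
  `p ∣ W.conductorNorm ℤ` — a THEOREM for all odd `p`, assembled from this file.

ON THE DISPLAYED READING `h32I` (no Heegner / `p ∣ N` binder): it is FALSE whenever `ρ̄_{E,p}` is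
induced from `K` (image `⊆ N(C)` with `K` the field of `N(C)/C`; e.g. 3Ns/3Nn, 5Nn, 7Ns images with
`K` their imaginary Cartan field): then `End_{Γ_K}(E[p]) ∋ A` non-scalar with `τ A τ = -A`, and for
any `τ`-eigenclass `c ∈ H¹(K, E[p])` the class `A_* c` is an eigenclass (opposite sign) independent
of `c` with `loc_λ(A_* c) = A_* loc_λ(c)` at EVERY place, so no prime gives `ord c_λ = p`,
`ord (A_*c)_λ = 1` — the prescribed-orders set is empty. Both (S)/(C) over `K` are thus NECESSARY;
§1's hypothesis is what the crux's rows supply (Heegner hypothesis for `N_E`, additive `p ∣ N_E`).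

HONEST FRAMING: nothing here asserts anything about any curve; the crux 20165, its stubs and BSD
are exactly as open as before. What changed: the Čebotarev input of the irreducible reading is no
longer a displayed hypothesis but a kernel theorem (under binders every use site holds).

References: [cite: McCallumLMS1991, §3 Cor. 3.2 (pp. 298–299)] [cite: GrossLMS1991, §9 Prop. 9.1]
[cite: Jetchev2008, Lemma 5.1, Rem. 6.2] [cite: Serre1972, §2.4 Prop. 15, §2.6, §5.4 proof of
Prop. 21 (Minkowski step)] [cite: SilvermanAEC2009, Prop. VII.4.1] [cite: Sah1968, Prop. 2.7 (b)].
-/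

set_option autoImplicit false
-- the Theorems directory repeats the summit name (sibling precedent `KatoDescentPotSupersingularAssembly.lean`)
set_option linter.dupNamespace false

noncomputable section

open scoped Classical Pointwise
open WeierstrassCurve NumberField IsDedekindDomain Field
open Literature.NumberTheory.GaloisRepresentations Literature.NumberTheory.EllipticCurves

universe u

namespace Summit.BirchSwinnertonDyer.BirchSwinnertonDyer.Theorems.JetchevIrreducibleCebotarev

variable (W : WeierstrassCurve ℚ) {K : Type u} [Field K] [NumberField K] {p : ℕ}

/-! ### §1. `ρ̄_{E,p}(Γ_K) = ρ̄_{E,p}(Γ_ℚ)` for `K` unramified at `p` and at the bad primes -/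

/-- **The image of `Γ_K` on `E[p]` is the whole image of `Γ_ℚ`** when `K` is a quadratic field
unramified at `p` and at every prime of bad reduction of `E = W` (globally: at every finite place
`v` of `ℚ`, either `K` is unramified at `v`, or `W` has good reduction at `v` and `v ∤ p`).
Proof (Serre 1972, §5.4, the Minkowski step of Prop. 21, run for `K`): if not, then since
`[Γ_ℚ : Γ_K] = 2` the subgroup `Γ_K` contains `Γ_{ℚ(E[p])} = ker ρ̄`; every inertia group `I_𝔓 ≤ Γ_ℚ`
lies in `Γ_K` — at the places of the second kind because `E[p]` is unramified there
(`galoisRepTorsion_eq_one_of_mem_inertia`, Silverman VII.4.1), at the others because `K` is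
unramified (`inertia_le_range_absGaloisRestrict_of_isUnramifiedIn`) — and an open subgroup of
index `2` of `Γ_ℚ` containing all inertia groups does not exist
(`WeierstrassCurve.false_of_index_two_of_forall_inertia_le`). Stated as: every `γ ∈ Γ_ℚ` acts on
`E[p]` as some element of `Γ_K` does. [cite: Serre1972, §5.4 (proof of Prop. 21)]
[cite: SilvermanAEC2009, Prop. VII.4.1] -/
theorem forall_exists_absGaloisRestrict_smul_eq_of_unramified [W.IsElliptic] [Fact p.Prime]
    (hK2 : Module.finrank ℚ K = 2)
    (hv : ∀ v : HeightOneSpectrum (𝓞 ℚ), Algebra.IsUnramifiedIn (𝓞 K) v.asIdeal ∨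
      (W.HasGoodReductionAt v ∧ (p : 𝓞 ℚ) ∉ v.asIdeal)) :
    ∀ γ : absoluteGaloisGroup ℚ, ∃ g : absoluteGaloisGroup K,
      ∀ P : geomTorsion W p, absGaloisRestrict ℚ K g • P = γ • P := by
  haveI : Algebra.IsQuadraticExtension ℚ K := ⟨hK2⟩
  set H : Subgroup (absoluteGaloisGroup ℚ) := (absGaloisRestrict ℚ K).range with hH
  have hHi : H.index = 2 := (index_range_absGaloisRestrict_eq_finrank ℚ K).trans hK2
  have hHo : IsOpen (H : Set (absoluteGaloisGroup ℚ)) := by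
    rw [hH, MonoidHom.coe_range]
    exact (isOpenMap_absGaloisRestrict K).isOpen_range
  by_contra hnot
  push Not at hnot
  obtain ⟨γ₀, hγ₀⟩ := hnot
  -- `ker ρ̄ ≤ H`
  have hker : torsionFixing W (p : ℤ) ≤ H := by
    intro δ hδ
    by_contra hδH
    have hγ₀H : γ₀ ∉ H := fun h ↦ by
      obtain ⟨g, hg⟩ := h
      obtain ⟨P, hP⟩ := hγ₀ g
      change absGaloisRestrict ℚ K g = γ₀ at hg
      exact hP (by rw [hg])
    -- `γ₀ δ⁻¹ ∈ H` (index two), and `δ⁻¹` fixes `E[p]`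
    have hmem : γ₀ * δ⁻¹ ∈ H := by
      rw [Subgroup.mul_mem_iff_of_index_two hHi]
      exact ⟨fun h ↦ absurd h hγ₀H, fun h ↦ absurd (H.inv_mem_iff.mp h) hδH⟩
    obtain ⟨g, hg⟩ := hmem
    change absGaloisRestrict ℚ K g = γ₀ * δ⁻¹ at hg
    obtain ⟨P, hP⟩ := hγ₀ g
    apply hP
    have hδP : δ⁻¹ • P = P := smul_eq_of_mem_torsionFixing W (p : ℤ) (inv_mem hδ) P
    rw [hg, mul_smul, hδP]
  -- every inertia group lies in `H`
  have hI : ∀ (v : HeightOneSpectrum (𝓞 ℚ)), ∀ 𝔓 ∈ v.primesAbove,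
      𝔓.inertia (absoluteGaloisGroup ℚ) ≤ H := by
    intro v 𝔓 h𝔓
    rcases hv v with hunr | ⟨hgood, hpv⟩
    · exact inertia_le_range_absGaloisRestrict_of_isUnramifiedIn (K := K) hunr h𝔓
    · intro τ hτ
      refine hker ((mem_torsionFixing_iff W (p : ℤ)).mpr fun P ↦ ?_)
      have h1 := W.galoisRepTorsion_eq_one_of_mem_inertia hgood (n := (p : ℤ))
        (by rwa [Int.cast_natCast]) h𝔓 hτ
      rw [← galoisRepTorsion_apply, h1]
      rfl
  exact WeierstrassCurve.false_of_index_two_of_forall_inertia_le hHo hHi hI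

/-- **Heegner form of §1**: for `K` imaginary quadratic satisfying the Heegner hypothesis for
`N_E = W.conductorNorm ℤ` (every `q ∣ N_E` splits in `K`) and `p ∣ N_E` (e.g. `p` additive), every
`γ ∈ Γ_ℚ` acts on `E[p]` as some element of `Γ_K`: the primes `q ∣ N_E` — among them `p` — are
unramified in `K` (x11b's `isUnramifiedIn_of_satisfiesHeegnerHypothesis_of_dvd`), the others are good
and prime to `p`. [cite: GrossLMS1991, §1 (Heegner hypothesis)] [cite: Serre1972, §5.4] -/
theorem forall_exists_absGaloisRestrict_smul_eq_of_satisfiesHeegnerHypothesis [W.IsElliptic]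
    [Fact p.Prime] (hK : IsImaginaryQuadratic K)
    (hHg : SatisfiesHeegnerHypothesis (W.conductorNorm ℤ) K) (hpN : p ∣ W.conductorNorm ℤ) :
    ∀ γ : absoluteGaloisGroup ℚ, ∃ g : absoluteGaloisGroup K,
      ∀ P : geomTorsion W p, absGaloisRestrict ℚ K g • P = γ • P := by
  have hp : p.Prime := Fact.out
  refine forall_exists_absGaloisRestrict_smul_eq_of_unramified W hK.1 fun v ↦ ?_
  obtain ⟨ℓ, hℓ, hℓv⟩ := exists_prime_natCast_mem v
  by_cases hℓN : ℓ ∣ W.conductorNorm ℤ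
  · exact Or.inl (Summit.BirchSwinnertonDyer.Rank1Residual.X11b.isUnramifiedIn_of_satisfiesHeegnerHypothesis_of_dvd
      hK hHg hℓ hℓN v hℓv)
  · right
    have hv : v = (Rat.HeightOneSpectrum.primesEquiv (R := 𝓞 ℚ)).symm ⟨ℓ, hℓ⟩ :=
      (natCast_mem_asIdeal_iff_eq_primesEquiv_symm v hℓ).mp hℓv
    have hpe : (Rat.HeightOneSpectrum.primesEquiv (R := 𝓞 ℚ) v : ℕ) = ℓ := by
      rw [hv, Equiv.apply_symm_apply]
    refine ⟨hasGoodReductionAt_of_not_dvd_conductorNorm W v (by rw [hpe]; exact hℓN), ?_⟩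
    have hne : ℓ ≠ p := fun h ↦ hℓN (h ▸ hpN)
    exact not_natCast_mem_of_prime_ne hℓ hp hne v hℓv

/-! ### §2. (S) and (C) over `K` from irreducibility over `ℚ` and §1 -/

/-- **(S): `E(K̄)[p]` is a simple `Γ_K`-module** when `E[p]` is an irreducible `Γ_ℚ`-module and
every `γ ∈ Γ_ℚ` acts on `E[p]` as some element of `Γ_K` (transport along `E(ℚ̄)[p] ≃ E(K̄)[p]`,
`RatClosure.torsionEquiv`, equivariant for `Γ_K → Γ_ℚ`). [folklore] [cite: GrossLMS1991, §9
("E_p is a simple 𝒢-module")] -/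
theorem simple_baseChange_of_irreducible (hirr : W.HasIrreducibleModPGaloisRep p)
    (hfull : ∀ γ : absoluteGaloisGroup ℚ, ∃ g : absoluteGaloisGroup K,
      ∀ P : geomTorsion W p, absGaloisRestrict ℚ K g • P = γ • P) :
    ∀ H : AddSubgroup (geomTorsion (W.baseChange K) p),
      (∀ g : absoluteGaloisGroup K, ∀ t ∈ H, g • t ∈ H) → H = ⊥ ∨ H = ⊤ := by
  intro H hH
  set θ := RatClosure.torsionEquiv (K := K) W p with hθ
  set H₀ : AddSubgroup (geomTorsion W p) := H.comap θ.toAddMonoidHom with hH₀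
  have hmem : ∀ P : geomTorsion W p, P ∈ H₀ ↔ θ P ∈ H := fun P ↦ Iff.rfl
  have hH₀stab : ∀ σ : absoluteGaloisGroup ℚ, ∀ P ∈ H₀, σ • P ∈ H₀ := by
    intro σ P hP
    obtain ⟨g, hg⟩ := hfull σ
    rw [hmem] at hP ⊢
    rw [← hg P, RatClosure.torsionEquiv_smul]
    exact hH g _ hP
  rcases hirr H₀ hH₀stab with h | h
  · left
    refine (AddSubgroup.eq_bot_iff_forall _).mpr fun t ht ↦ ?_
    have : θ.symm t ∈ H₀ := by rw [hmem, AddEquiv.apply_symm_apply]; exact ht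
    rw [h, AddSubgroup.mem_bot] at this
    rw [← θ.apply_symm_apply t, this, map_zero]
  · right
    refine (AddSubgroup.eq_top_iff' _).mpr fun t ↦ ?_
    have : θ.symm t ∈ H₀ := by rw [h]; trivial
    rw [hmem, AddEquiv.apply_symm_apply] at this
    exact this

/-- **The `+1`-eigenspace of complex conjugation on `E[p]` is the line through `e₊`** (`p` odd):
if `c₀ e₊ = e₊ ≠ 0` and some `e₋ ≠ 0` has `c₀ e₋ = -e₋`, then every `P` with `c₀ P = P` is a
multiple of `e₊` (otherwise `⟨e₊, P⟩` has order `> p`, i.e. is all of `E[p] ≅ (ℤ/p)²`, so `c₀ = 1` on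
`E[p]` and `2e₋ = 0`). Gross 1991, Prop. 9.5 (1): `E_p^± ≃ ℤ/pℤ`. [cite: GrossLMS1991, Prop. 9.5 (1)] -/
theorem mem_zmultiples_of_smul_eq [W.IsElliptic] [Fact p.Prime] (hp2 : p ≠ 2)
    {c₀ : absoluteGaloisGroup ℚ} {ePlus eMinus : geomTorsion W p} (hPlus0 : ePlus ≠ 0)
    (hPlus : c₀ • ePlus = ePlus) (hMinus0 : eMinus ≠ 0) (hMinus : c₀ • eMinus = -eMinus)
    {P : geomTorsion W p} (hP : c₀ • P = P) : P ∈ AddSubgroup.zmultiples ePlus := by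
  have hp : p.Prime := Fact.out
  have hcard : Nat.card (geomTorsion W p) = p ^ 2 :=
    card_torsionPoints_eq_sq_holds W (AlgebraicClosure ℚ) (n := p) (Nat.cast_ne_zero.mpr hp.ne_zero)
  haveI : Finite (geomTorsion W p) :=
    Nat.finite_of_card_ne_zero (by rw [hcard]; exact pow_ne_zero _ hp.ne_zero)
  have hkill : ∀ Q : geomTorsion W p, (p : ℤ) • Q = 0 := fun Q ↦ Subtype.ext (by
    rw [AddSubgroupClass.coe_zsmul, ZeroMemClass.coe_zero]
    exact (mem_geomTorsion_iff W _ (Q : geomPoints W)).mp Q.2)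
  by_contra hPL
  -- the subgroup generated by `e₊` and `P` is everything
  have hLcard : Nat.card (AddSubgroup.zmultiples ePlus) = p := by
    rw [Nat.card_zmultiples]
    exact addOrderOf_eq_prime (by rw [← natCast_zsmul]; exact hkill ePlus) hPlus0
  have hLL' : AddSubgroup.zmultiples ePlus ≤ AddSubgroup.closure {ePlus, P} := by
    rw [AddSubgroup.zmultiples_le]
    exact AddSubgroup.subset_closure (Set.mem_insert _ _)
  have hPL' : P ∈ AddSubgroup.closure {ePlus, P} :=
    AddSubgroup.subset_closure (Set.mem_insert_of_mem _ (Set.mem_singleton _))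
  have hL'top : AddSubgroup.closure {ePlus, P} = ⊤ := by
    have hdvd : Nat.card (AddSubgroup.closure {ePlus, P}) ∣ p ^ 2 := by
      rw [← hcard]; exact AddSubgroup.card_addSubgroup_dvd_card _
    have hdvd' : p ∣ Nat.card (AddSubgroup.closure {ePlus, P}) := by
      have h := AddSubgroup.card_dvd_of_le hLL'
      rwa [hLcard] at h
    obtain ⟨k, hk, hkeq⟩ := (Nat.dvd_prime_pow hp).mp hdvd
    have hk1 : k ≠ 0 := by
      rintro rfl
      rw [hkeq, pow_zero, Nat.dvd_one] at hdvd'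
      exact hp.one_lt.ne' hdvd'
    have hk2 : k ≠ 1 := by
      rintro rfl
      rw [pow_one] at hkeq
      -- the closure equals the line by cardinality, contradicting `P ∉ ⟨e₊⟩`
      have : AddSubgroup.zmultiples ePlus = AddSubgroup.closure {ePlus, P} :=
        AddSubgroup.eq_of_le_of_card_ge hLL' (by rw [hLcard, hkeq])
      exact hPL (this ▸ hPL')
    have hk' : k = 2 := by omega
    exact AddSubgroup.eq_top_of_card_eq _ (by rw [hkeq, hk', hcard])
  -- so `c₀` acts trivially on `E[p]`, contradicting `e₋`
  have htriv : ∀ Q : geomTorsion W p, c₀ • Q = Q := by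
    intro Q
    have hQ : Q ∈ AddSubgroup.closure {ePlus, P} := by rw [hL'top]; trivial
    refine AddSubgroup.closure_induction (fun x hx ↦ ?_) (smul_zero _) (fun x y _ _ hx hy ↦ ?_)
      (fun x _ hx ↦ ?_) hQ
    · rcases hx with rfl | rfl
      · exact hPlus
      · exact hP
    · rw [smul_add, hx, hy]
    · rw [smul_neg, hx]
  have h2 : (2 : ℤ) • eMinus = 0 := by
    have := htriv eMinus
    rw [hMinus] at this
    rw [two_smul]
    exact neg_eq_iff_add_eq_zero.mp this
  -- `2` and `p` are coprime, so `e₋ = 0`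
  apply hMinus0
  have hodd : Odd p := hp.odd_of_ne_two hp2
  obtain ⟨c, hc⟩ := hodd
  have : eMinus = (p : ℤ) • eMinus - (c : ℤ) • ((2 : ℤ) • eMinus) := by
    rw [smul_smul, ← sub_smul, show (p : ℤ) - c * 2 = 1 by rw [hc]; push_cast; ring, one_smul]
  rw [this, h2, smul_zero, sub_zero, hkill]

/-- **(C): the `Γ_K`-commutant of `E(K̄)[p]` is scalar** when `E[p]` is an irreducible
`Γ_ℚ`-module, every `γ ∈ Γ_ℚ` acts on `E[p]` as some element of `Γ_K`, and `p` is odd: an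
equivariant endomorphism `f` commutes with complex conjugation `c₀`, so `f e₊` lies in the
`c₀`-fixed line `𝔽_p e₊`, `f e₊ = α e₊`; then `{Q : f Q = α Q}` is a non-zero stable subgroup, hence
everything (the absolute irreducibility of an odd irreducible `ρ̄`; Gross 1991 Prop. 9.3's
`Hom_𝒢(…, E_p) ≃ (ℤ/p)^s`). [cite: GrossLMS1991, Prop. 9.3 (proof)] [cite: Jetchev2008, Rem. 6.2] -/
theorem exists_eq_zsmul_baseChange_of_irreducible [W.IsElliptic] [Fact p.Prime] (hp2 : p ≠ 2)
    (hirr : W.HasIrreducibleModPGaloisRep p)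
    (hfull : ∀ γ : absoluteGaloisGroup ℚ, ∃ g : absoluteGaloisGroup K,
      ∀ P : geomTorsion W p, absGaloisRestrict ℚ K g • P = γ • P) :
    ∀ f : geomTorsion (W.baseChange K) p →+ geomTorsion (W.baseChange K) p,
      (∀ (g : absoluteGaloisGroup K) (t : geomTorsion (W.baseChange K) p), f (g • t) = g • f t) →
        ∃ k : ℤ, ∀ t, f t = k • t := by
  intro f hf
  have hW : W.exists_weilPairing p := W.exists_weilPairing_holds p
  set θ := RatClosure.torsionEquiv (K := K) W p with hθ
  -- the transported endomorphism `f₀ = θ⁻¹ f θ` of `E(ℚ̄)[p]` commutes with `Γ_ℚ`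
  set f₀ : geomTorsion W p →+ geomTorsion W p :=
    θ.symm.toAddMonoidHom.comp (f.comp θ.toAddMonoidHom) with hf₀
  have hf₀app : ∀ P, f₀ P = θ.symm (f (θ P)) := fun _ ↦ rfl
  have hf₀ : ∀ (γ : absoluteGaloisGroup ℚ) (P : geomTorsion W p), f₀ (γ • P) = γ • f₀ P := by
    intro γ P
    obtain ⟨g, hg⟩ := hfull γ
    apply θ.injective
    rw [hf₀app, hf₀app, AddEquiv.apply_symm_apply, ← hg, ← hg, RatClosure.torsionEquiv_smul,
      RatClosure.torsionEquiv_smul, AddEquiv.apply_symm_apply, hf]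
  -- complex conjugation and its eigenvectors on `E[p]`
  obtain ⟨c₀, hc₀⟩ := exists_isComplexConjugation (Rat.castHom ℝ)
  obtain ⟨⟨vPlus, hvPlus0, hvPlus⟩, ⟨vMinus, hvMinus0, hvMinus⟩⟩ :=
    RatClosure.exists_eigenvectors W hc₀ hW hp2
  -- `f₀ e₊` is `c₀`-fixed, hence a multiple of `e₊`
  have hfix : c₀ • f₀ vPlus = f₀ vPlus := by rw [← hf₀, hvPlus]
  obtain ⟨α, hα⟩ := AddSubgroup.mem_zmultiples_iff.mp
    (mem_zmultiples_of_smul_eq W hp2 hvPlus0 hvPlus hvMinus0 hvMinus hfix)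
  -- the `α`-eigenspace of `f₀` is stable and non-zero, hence everything
  set Hα : AddSubgroup (geomTorsion W p) :=
    { carrier := {Q | f₀ Q = α • Q}
      zero_mem' := by simp
      add_mem' := fun {x y} hx hy ↦ by
        simp only [Set.mem_setOf_eq] at hx hy ⊢
        rw [map_add, hx, hy, smul_add]
      neg_mem' := fun {x} hx ↦ by
        simp only [Set.mem_setOf_eq] at hx ⊢
        rw [map_neg, hx, smul_neg] } with hHα
  have hHαmem : ∀ Q, Q ∈ Hα ↔ f₀ Q = α • Q := fun _ ↦ Iff.rfl
  have hHαstab : ∀ σ : absoluteGaloisGroup ℚ, ∀ Q ∈ Hα, σ • Q ∈ Hα := by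
    intro σ Q hQ
    rw [hHαmem] at hQ ⊢
    rw [hf₀, hQ, smul_comm]
  have hHαtop : Hα = ⊤ := by
    rcases hirr Hα hHαstab with h | h
    · exfalso
      apply hvPlus0
      have : vPlus ∈ Hα := by rw [hHαmem, hα]
      rw [h] at this
      exact (AddSubgroup.mem_bot).mp this
    · exact h
  refine ⟨α, fun t ↦ ?_⟩
  have ht : θ.symm t ∈ Hα := by rw [hHαtop]; trivial
  rw [hHαmem, hf₀app, AddEquiv.apply_symm_apply] at ht
  apply θ.symm.injective
  rw [ht, map_zsmul]

/-! ### §3. (Z): a non-trivial scalar realised by `Γ_K`, at every odd irreducible `p` -/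

/-- **A scalar `a ≢ 1 (mod p)` in `ρ̄_{E,p}(Γ_ℚ)` at every odd `p` with `E[p]` irreducible**: `-1`
if `ρ̄_{E,p}` is onto; otherwise Serre 1972 §2.6 in the tree —
`WeierstrassCurve.exists_galoisRepTorsion_eq_smul_of_not_surjective` (`p ≥ 5`: normaliser-of-Cartan
and exceptional images contain a non-trivial homothety) and `…_three` (`p = 3`: a `2`-group image
contains the central `-1`). [cite: Serre1972, §2.4 Prop. 15, §2.6] -/
theorem exists_smul_eq_smul_of_irreducible [W.IsElliptic] [Fact p.Prime] (hp2 : p ≠ 2)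
    (hirr : W.HasIrreducibleModPGaloisRep p) :
    ∃ (σ : absoluteGaloisGroup ℚ) (a : ℤ), ¬ (p : ℤ) ∣ a - 1 ∧
      ∀ P : geomTorsion W p, σ • P = a • P := by
  have hp : p.Prime := Fact.out
  by_cases hsurj : W.HasSurjectiveModNGaloisRep p
  · obtain ⟨γ₀, hγ₀⟩ := hsurj (Multiplicative.ofAdd (AddEquiv.neg (geomTorsion W p)))
    refine ⟨γ₀, -1, fun h ↦ ?_, fun P ↦ ?_⟩
    · have : (p : ℤ) ∣ 2 := by
        have h' : (-1 : ℤ) - 1 = -2 := by norm_num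
        rw [h'] at h
        exact (Int.dvd_neg).mp h
      have := Int.le_of_dvd (by norm_num) this
      have := hp.two_le
      omega
    · rw [← galoisRepTorsion_apply, hγ₀, neg_one_zsmul]
      rfl
  · -- not onto: Serre's scalar
    obtain ⟨σ, a, ha1, hσ⟩ : ∃ (σ : absoluteGaloisGroup ℚ) (a : ZMod p), a ≠ 1 ∧
        ∀ x : geomTorsion W p, Multiplicative.toAdd (galoisRepTorsion W p σ) x = a.val • x := by
      by_cases hp3 : p = 3
      · exact W.exists_galoisRepTorsion_eq_smul_of_not_surjective_three p hp3 hirr hsurj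
      · have hp5 : 5 ≤ p := by
          rcases hp.eq_two_or_odd' with h | h
          · exact absurd h hp2
          · obtain ⟨k, hk⟩ := h
            have : p ≠ 1 := hp.one_lt.ne'
            omega
        exact W.exists_galoisRepTorsion_eq_smul_of_not_surjective p hp5 hirr hsurj
    refine ⟨σ, (a.val : ℤ), fun h ↦ ha1 ?_, fun P ↦ ?_⟩
    · have : ((a.val : ℤ) : ZMod p) = ((1 : ℤ) : ZMod p) :=
        (ZMod.intCast_eq_intCast_iff_dvd_sub _ _ _).mpr (by simpa using Int.dvd_neg.mpr h)
      simpa using this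
    · rw [← galoisRepTorsion_apply, hσ P, natCast_zsmul]

/-- **(Z) over `K`**: a `z ∈ Γ_K` acting on `E(K̄)[p]` as a scalar `a ≢ 1 (mod p)`, for `p` odd with
`E[p]` irreducible and every `γ ∈ Γ_ℚ` acting on `E[p]` as some element of `Γ_K` (§1).
[cite: Serre1972, §2.6] [cite: GrossLMS1991, Prop. 9.1 (the homothety)] -/
theorem exists_smul_eq_smul_baseChange_of_irreducible [W.IsElliptic] [Fact p.Prime] (hp2 : p ≠ 2)
    (hirr : W.HasIrreducibleModPGaloisRep p)
    (hfull : ∀ γ : absoluteGaloisGroup ℚ, ∃ g : absoluteGaloisGroup K,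
      ∀ P : geomTorsion W p, absGaloisRestrict ℚ K g • P = γ • P) :
    ∃ (z : absoluteGaloisGroup K) (a : ℤ), ¬ (p : ℤ) ∣ a - 1 ∧
      ∀ P : geomTorsion (W.baseChange K) p, z • P = a • P := by
  obtain ⟨σ, a, ha1, hσ⟩ := exists_smul_eq_smul_of_irreducible W hp2 hirr
  obtain ⟨g, hg⟩ := hfull σ
  refine ⟨g, a, ha1, fun Q ↦ ?_⟩
  set θ := RatClosure.torsionEquiv (K := K) W p with hθ
  obtain ⟨P, rfl⟩ := θ.surjective Q
  rw [← RatClosure.torsionEquiv_smul, hg, hσ, map_zsmul]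

end Summit.BirchSwinnertonDyer.BirchSwinnertonDyer.Theorems.JetchevIrreducibleCebotarev

end
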